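import Summits.CriticalPhenomena.Ising3DConformalLimit.Theorems.PrecisionLaplacianMoebiusLimitOfTwoPointLawBareFactorisation
import Summits.CriticalPhenomena.Ising3DConformalLimit.Theorems.GaussianScaleMixtureRotationUpgradeFromTwoPoint
import HarnessLib

/-!
# Crux `PrecisionLaplacian.MoebiusLimitOfTwoPointLaw` (item stmt-CriticalPhenomena-4801) — the strategist's split
# into the two existing open items 4738 (`WeylWindow.LimitExists`) and 1982
# (`HyperoctahedralRP.InversionUpgradeNormalised`); `--supports stmt-CriticalPhenomena-4801`

The landed exact residue `crux ↔ (0634 → 4738 ∧ 8367 ∧ 1982)` (`moebiusLimitOfTwoPointLaw_iff_bare₂`, p117654) has lost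
its middle factor: item stmt-CriticalPhenomena-8367 `GaussianScaleMixture.RotationUpgradeFromTwoPoint` (the `n`-point `O(3)`
upgrade from two-point isotropy) is a theorem of the tree (`rotationUpgradeFromTwoPoint_proof`, line
`null-laplacian-edge-gaussianity` of crux 8367, using the `quarter-turn-liouville` machinery of crux 1980). Hence, with no
Ising-specific mathematics in this file (routing glue over landed theorems only):

* `MoebiusLimitOfTwoPointLaw_of_subs : WeylWindow.LimitExists → HyperoctahedralRP.InversionUpgradeNormalised →
  PrecisionLaplacian.MoebiusLimitOfTwoPointLaw` — the glue `Sub₁ → Sub₂ → Crux` of the two-child split of the crux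
  (registered sub-goal of item 4801; `BernsteinTemperature` spelling `MoebiusLimitOfTwoPointLaw_of_subs'`);
* `moebiusLimitOfTwoPointLaw_iff_subs : crux ↔ (0634 → 4738 ∧ 1982)` — the residue is now EXACTLY "bare existence of a
  non-degenerate pointwise scaling limit of the critical `ℤ³` correlators (the existence problem, item 4738 ⇔ 1981 under 0634)
  + inversion covariance of every normalised Euclidean scale-covariant non-degenerate limit (the conformal problem, item 1982)";
* `limitExists_of_crux`, `inversionUpgradeNormalised_of_crux` — each child is necessary given item 0634;
* `limitRotationInvariant_of_twoPointLaw` — under item 0634 the conclusion of item 1980 holds for every limit, by name.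

References: H. Duminil-Copin, *100 years of the (critical) Ising model on the hypercubic lattice*, ICM 2022, §8.4 p. 29
(existence of the scaling limit and its conformal covariance on `ℤ³` are open). No definitions, no `sorry`.
-/

noncomputable section

namespace Summit.CriticalPhenomena.Ising3DConformalLimit.PrecisionLaplacianMoebiusLimitOfTwoPointLawSplit

open Summit.CriticalPhenomena.Ising3DConformalLimit.Theses
open Summit.CriticalPhenomena.Ising3DConformalLimit.PrecisionLaplacianMoebiusLimitOfTwoPointLaw
  (moebiusLimitOfTwoPointLaw_of_bare₂ moebiusLimitOfTwoPointLaw_iff_bare₂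
    limitRotationInvariant_of_rotationUpgradeFromTwoPoint)
open Summit.CriticalPhenomena.Ising3DConformalLimit.Cruxes.RotationUpgradeFromTwoPoint.NullLaplacianEdgeGaussianity
  (rotationUpgradeFromTwoPoint_proof)

/-- The `O(3)` factor of the old three-factor residue is a theorem of the tree (item stmt-CriticalPhenomena-8367, proved by
line `null-laplacian-edge-gaussianity`). [folklore] -/
theorem rotationUpgradeFromTwoPoint_holds : GaussianScaleMixture.RotationUpgradeFromTwoPoint :=
  rotationUpgradeFromTwoPoint_proof

/-- **Split glue** `Sub₁ → Sub₂ → Crux` (registered sub-goal `MoebiusLimitOfTwoPointLaw_of_subs` of item 4801):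
bare existence of a non-degenerate pointwise limit (item 4738) and the inversion upgrade (item 1982) give the crux; the
rotation upgrade in between is the landed proof of item 8367. [cite: DuminilCopinICM2022, §8.4 p. 29] -/
theorem MoebiusLimitOfTwoPointLaw_of_subs :
    WeylWindow.LimitExists → HyperoctahedralRP.InversionUpgradeNormalised →
      PrecisionLaplacian.MoebiusLimitOfTwoPointLaw :=
  fun hL hI => moebiusLimitOfTwoPointLaw_of_bare₂ hL rotationUpgradeFromTwoPoint_proof hI

/-- The split glue for the `BernsteinTemperature` spelling of the crux (identical definiens).
[cite: DuminilCopinICM2022, §8.4 p. 29] -/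
theorem MoebiusLimitOfTwoPointLaw_of_subs'
    (hL : WeylWindow.LimitExists) (hI : HyperoctahedralRP.InversionUpgradeNormalised) :
    BernsteinTemperature.MoebiusLimitOfTwoPointLaw :=
  MoebiusLimitOfTwoPointLaw_of_subs hL hI

/-- **Exact two-factor residue** `crux ↔ (0634 → 4738 ∧ 1982)`: given the two-point law, crux 4801 is exactly the
existence problem plus the inversion (conformal) problem. [cite: DuminilCopinICM2022, §8.4 p. 29] -/
theorem moebiusLimitOfTwoPointLaw_iff_subs :
    PrecisionLaplacian.MoebiusLimitOfTwoPointLaw ↔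
      (IsingEuclidUpgrade.IsingEuclidUpgradeR2RotInvPowerLaw →
        WeylWindow.LimitExists ∧ HyperoctahedralRP.InversionUpgradeNormalised) := by
  rw [moebiusLimitOfTwoPointLaw_iff_bare₂]
  constructor
  · intro h hP
    exact ⟨(h hP).1, (h hP).2.2⟩
  · intro h hP
    exact ⟨(h hP).1, rotationUpgradeFromTwoPoint_proof, (h hP).2⟩

/-- The first child is NECESSARY given item 0634: the crux and the two-point law give bare existence (item 4738).
[cite: DuminilCopinICM2022, §8.4 p. 29] -/
theorem limitExists_of_crux (h : PrecisionLaplacian.MoebiusLimitOfTwoPointLaw)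
    (hP : IsingEuclidUpgrade.IsingEuclidUpgradeR2RotInvPowerLaw) : WeylWindow.LimitExists :=
  ((moebiusLimitOfTwoPointLaw_iff_subs.1 h) hP).1

/-- The second child is NECESSARY given item 0634: the crux and the two-point law give the inversion upgrade for every
normalised Euclidean scale-covariant non-degenerate limit (item 1982). [cite: DuminilCopinICM2022, §8.4 p. 29] -/
theorem inversionUpgradeNormalised_of_crux (h : PrecisionLaplacian.MoebiusLimitOfTwoPointLaw)
    (hP : IsingEuclidUpgrade.IsingEuclidUpgradeR2RotInvPowerLaw) : HyperoctahedralRP.InversionUpgradeNormalised :=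
  ((moebiusLimitOfTwoPointLaw_iff_subs.1 h) hP).2

/-- Under item 0634 the conclusion of item 1980 `HyperoctahedralRP.LimitRotationInvariant` holds by name (landed edge
`limitRotationInvariant_of_rotationUpgradeFromTwoPoint` and the proof of item 8367). [folklore] -/
theorem limitRotationInvariant_of_twoPointLaw (hP : IsingEuclidUpgrade.IsingEuclidUpgradeR2RotInvPowerLaw) :
    HyperoctahedralRP.LimitRotationInvariant :=
  limitRotationInvariant_of_rotationUpgradeFromTwoPoint hP rotationUpgradeFromTwoPoint_proof

end Summit.CriticalPhenomena.Ising3DConformalLimit.PrecisionLaplacianMoebiusLimitOfTwoPointLawSplit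

end
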